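import Summits.Parity.GeneralizedHardyLittlewood.Theorems.PrimeLevelFamEdgeMomentsBeyondDiagonalDiagDecorWeightGeneric
import HarnessLib

/-!
# Route `PrimeLevelFamEdge`, crux K_A `MomentsBeyondDiagonal` (stmt-Parity-20007), line «petersson_layers» v4, stub `stub_diag`:
# **the rung-2 weight algebra in closed form: `M_4 = τ(3P₂² − 2P₄)` on squarefree numbers and the Hecke-divisor sums
# `Σ_{d,e}A₂²`, `Σ_{d,e}A₁²A₂`, `Σ_{d,e}A₁A₂²`, `Σ_{d,e}A₁²A₂²`**

Instances of the generic weight algebra `…DiagDecorWeightGeneric.sum_divisors_sum_divisors_A1_pow_mul_A2_pow_eq` needed at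
rung `N = 2` of the `stub_diag` ladder (orders `(2,0)`, `(0,2)`, `(2,2)`; `(2,0)` itself is `…A1_sq_of_squarefree` there), with
`A₁ = X − log e − log(k₁/d)`, `A₂ = X − log d − log(k₂/e)`, `L = 2X − log k₁ − log k₂`, `P₂(k) = Σ_{p∣k}log²p`,
`P₄(k) = Σ_{p∣k}log⁴p`, `τ = #divisors`, on squarefree `k₁, k₂`:

* `centralMoment_three` — `M_3 = 0`; `centralMoment_four_of_squarefree` — **`Σ_{d∣k}(2log d − log k)⁴ = τ(k)(3P₂(k)² − 2P₄(k))`**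
  (fourth moment of `Σ_{p∣k} ±log p`: `3(Σa_p²)² − 2Σa_p⁴`);
* `sum_divisors_sum_divisors_A2_sq_of_squarefree` — `Σ_{d,e}A₂² = ττ(L²/4 + (P₂(k₁)+P₂(k₂))/4)`;
* `sum_divisors_sum_divisors_A1_sq_mul_A2_of_squarefree`, `…_A1_mul_A2_sq_of_squarefree` —
  **`Σ_{d,e}A₁²A₂ = Σ_{d,e}A₁A₂² = ττ(L³ − L(P₂(k₁)+P₂(k₂)))/8`**;
* `sum_divisors_sum_divisors_A1_sq_mul_A2_sq_of_squarefree` —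
  **`Σ_{d,e}A₁²A₂² = ττ(L⁴ − 2L²(P₂(k₁)+P₂(k₂)) + 3(P₂(k₁)+P₂(k₂))² − 2(P₄(k₁)+P₄(k₂)))/16`**.

So at rung 2 the new decorations beyond `τ`, `τP₂` are `τP₂(k₁)·τP₂(k₂)` (two-sided), `τP₂²` and `τP₄` (one-sided, order
`(2,2)` only). Exact identities; def-free; theorems only. Helper `--supports stmt-Parity-20007`; closes nothing; K_A, K_B and
the Parity summit are NOT proved; nothing about Landau–Siegel zeros.

## References
* E. Kowalski, P. Michel, J. VanderKam, J. reine angew. Math. 526 (2000), (23)–(28) pp. 13–15.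
  [cite: KowalskiMichelVanderKam2000, (23)–(28) — derivation (Hecke-divisor bookkeeping of the order-(i,j) diagonal weight)]
-/

noncomputable section

open scoped Real ArithmeticFunction.Moebius
open Finset ArithmeticFunction Polynomial

namespace Summit.Parity.GeneralizedHardyLittlewood.Theorems.MomentsBeyondDiagonal.DiagKernel

open Literature.NumberTheory.LFunctions Literature.NumberTheory.LFunctions.KMV2000

/-! ### The third and fourth central divisor-log moments -/

/-- `M_3(k) = 0`. [folklore] -/
theorem centralMoment_three (k : ℕ) : ∑ d ∈ k.divisors, (2 * Real.log d - Real.log k) ^ 3 = 0 :=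
  centralMoment_eq_zero_of_odd (by decide) k

/-- **`M_4 = τ·(3P₂² − 2P₄)` on squarefree numbers**: `Σ_{d∣k}(2log d − log k)⁴ = τ(k)·(3(Σ_{p∣k}log²p)² − 2Σ_{p∣k}log⁴p)`
for squarefree `k` (fourth moment of a sum of independent signs). [folklore] -/
theorem centralMoment_four_of_squarefree {k : ℕ} (hk : Squarefree k) :
    ∑ d ∈ k.divisors, (2 * Real.log d - Real.log k) ^ 4 =
      (k.divisors.card : ℝ) *
        (3 * (∑ p ∈ k.primeFactors, Real.log p ^ 2) ^ 2 - 2 * ∑ p ∈ k.primeFactors, Real.log p ^ 4) := by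
  induction k using Nat.recOnPosPrimePosCoprime with
  | zero => exact absurd hk not_squarefree_zero
  | one => simp
  | prime_pow p n hp hn =>
    have hn1 : n = 1 := ((Nat.squarefree_pow_iff hp.ne_one hn.ne').1 hk).2
    subst hn1
    rw [pow_one, centralMoment_prime 4 hp, hp.divisors, Finset.card_pair hp.one_lt.ne, hp.primeFactors,
      Finset.sum_singleton, Finset.sum_singleton]
    ring
  | coprime a b ha hb hab iha ihb =>
    have hsq := Nat.squarefree_mul_iff.1 hk
    have ha0 : a ≠ 0 := by omega
    have hb0 : b ≠ 0 := by omega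
    have hmul := centralMoment_mul_of_coprime 4 ha0 hb0 hab
    push_cast at hmul ⊢
    rw [hmul]
    simp only [Finset.sum_range_succ, Finset.sum_range_zero, zero_add, Nat.sub_self, Nat.sub_zero,
      iha hsq.2.1, ihb hsq.2.2, centralMoment_one, centralMoment_zero, centralMoment_three,
      centralMoment_two_of_squarefree hsq.2.1, centralMoment_two_of_squarefree hsq.2.2]
    rw [Nat.Coprime.card_divisors_mul hab, Nat.Coprime.primeFactors_mul hab,
      Finset.sum_union (Nat.Coprime.disjoint_primeFactors hab),
      Finset.sum_union (Nat.Coprime.disjoint_primeFactors hab)]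
    push_cast
    norm_num [Nat.choose]
    ring

/-! ### The rung-2 Hecke-divisor sums on squarefree numbers -/

/-- **`Σ_{d∣k₁}Σ_{e∣k₂} A₂² = τ(k₁)τ(k₂)·(L²/4 + (P₂(k₁) + P₂(k₂))/4)`** for squarefree `k₁, k₂` (order `(0,2)`, the mirror
of `…A1_sq_of_squarefree`). [cite: KowalskiMichelVanderKam2000, (23)–(28) — derivation] -/
theorem sum_divisors_sum_divisors_A2_sq_of_squarefree (X : ℝ) {k₁ k₂ : ℕ} (hk₁ : Squarefree k₁)
    (hk₂ : Squarefree k₂) :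
    ∑ d ∈ k₁.divisors, ∑ e ∈ k₂.divisors, (X - Real.log d - Real.log ((k₂ / e : ℕ) : ℝ)) ^ 2 =
      (k₁.divisors.card : ℝ) * (k₂.divisors.card : ℝ) *
        ((2 * X - Real.log k₁ - Real.log k₂) ^ 2 / 4 +
          ((∑ p ∈ k₁.primeFactors, Real.log p ^ 2) + ∑ p ∈ k₂.primeFactors, Real.log p ^ 2) / 4) := by
  have h := sum_divisors_sum_divisors_A1_pow_mul_A2_pow_eq X 0 2 k₁ k₂
  have hL : ∑ d ∈ k₁.divisors, ∑ e ∈ k₂.divisors, (X - Real.log d - Real.log ((k₂ / e : ℕ) : ℝ)) ^ 2 =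
      ∑ d ∈ k₁.divisors, ∑ e ∈ k₂.divisors,
        (X - Real.log e - Real.log ((k₁ / d : ℕ) : ℝ)) ^ 0 * (X - Real.log d - Real.log ((k₂ / e : ℕ) : ℝ)) ^ 2 := by
    simp only [pow_zero, one_mul]
  rw [hL, h]
  simp only [Finset.sum_range_succ, Finset.sum_range_zero, zero_add, Nat.sub_self, Nat.sub_zero,
    centralMoment_zero, centralMoment_one,
    centralMoment_two_of_squarefree hk₁, centralMoment_two_of_squarefree hk₂]
  push_cast
  norm_num [Nat.choose]
  ring

/-- **`Σ_{d∣k₁}Σ_{e∣k₂} A₁²A₂ = τ(k₁)τ(k₂)·(L³ − L(P₂(k₁) + P₂(k₂)))/8`** for squarefree `k₁, k₂`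
(`(L²−δ²)(L+δ)/8` summed: `J₁ = J₃ = 0`). [cite: KowalskiMichelVanderKam2000, (23)–(28) — derivation] -/
theorem sum_divisors_sum_divisors_A1_sq_mul_A2_of_squarefree (X : ℝ) {k₁ k₂ : ℕ} (hk₁ : Squarefree k₁)
    (hk₂ : Squarefree k₂) :
    ∑ d ∈ k₁.divisors, ∑ e ∈ k₂.divisors,
        (X - Real.log e - Real.log ((k₁ / d : ℕ) : ℝ)) ^ 2 * (X - Real.log d - Real.log ((k₂ / e : ℕ) : ℝ)) =
      (k₁.divisors.card : ℝ) * (k₂.divisors.card : ℝ) *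
        (((2 * X - Real.log k₁ - Real.log k₂) ^ 3 -
          (2 * X - Real.log k₁ - Real.log k₂) *
            ((∑ p ∈ k₁.primeFactors, Real.log p ^ 2) + ∑ p ∈ k₂.primeFactors, Real.log p ^ 2)) / 8) := by
  have h := sum_divisors_sum_divisors_A1_pow_mul_A2_pow_eq X 2 1 k₁ k₂
  have hL : ∑ d ∈ k₁.divisors, ∑ e ∈ k₂.divisors,
      (X - Real.log e - Real.log ((k₁ / d : ℕ) : ℝ)) ^ 2 * (X - Real.log d - Real.log ((k₂ / e : ℕ) : ℝ)) =
      ∑ d ∈ k₁.divisors, ∑ e ∈ k₂.divisors,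
        (X - Real.log e - Real.log ((k₁ / d : ℕ) : ℝ)) ^ 2 * (X - Real.log d - Real.log ((k₂ / e : ℕ) : ℝ)) ^ 1 := by
    simp only [pow_one]
  rw [hL, h]
  simp only [Finset.sum_range_succ, Finset.sum_range_zero, zero_add, Nat.sub_self, Nat.sub_zero,
    centralMoment_zero, centralMoment_one, centralMoment_three,
    centralMoment_two_of_squarefree hk₁, centralMoment_two_of_squarefree hk₂]
  push_cast
  norm_num [Nat.choose]
  ring

/-- **`Σ_{d∣k₁}Σ_{e∣k₂} A₁A₂² = τ(k₁)τ(k₂)·(L³ − L(P₂(k₁) + P₂(k₂)))/8`** for squarefree `k₁, k₂`.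
[cite: KowalskiMichelVanderKam2000, (23)–(28) — derivation] -/
theorem sum_divisors_sum_divisors_A1_mul_A2_sq_of_squarefree (X : ℝ) {k₁ k₂ : ℕ} (hk₁ : Squarefree k₁)
    (hk₂ : Squarefree k₂) :
    ∑ d ∈ k₁.divisors, ∑ e ∈ k₂.divisors,
        (X - Real.log e - Real.log ((k₁ / d : ℕ) : ℝ)) * (X - Real.log d - Real.log ((k₂ / e : ℕ) : ℝ)) ^ 2 =
      (k₁.divisors.card : ℝ) * (k₂.divisors.card : ℝ) *
        (((2 * X - Real.log k₁ - Real.log k₂) ^ 3 -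
          (2 * X - Real.log k₁ - Real.log k₂) *
            ((∑ p ∈ k₁.primeFactors, Real.log p ^ 2) + ∑ p ∈ k₂.primeFactors, Real.log p ^ 2)) / 8) := by
  have h := sum_divisors_sum_divisors_A1_pow_mul_A2_pow_eq X 1 2 k₁ k₂
  have hL : ∑ d ∈ k₁.divisors, ∑ e ∈ k₂.divisors,
      (X - Real.log e - Real.log ((k₁ / d : ℕ) : ℝ)) * (X - Real.log d - Real.log ((k₂ / e : ℕ) : ℝ)) ^ 2 =
      ∑ d ∈ k₁.divisors, ∑ e ∈ k₂.divisors,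
        (X - Real.log e - Real.log ((k₁ / d : ℕ) : ℝ)) ^ 1 * (X - Real.log d - Real.log ((k₂ / e : ℕ) : ℝ)) ^ 2 := by
    simp only [pow_one]
  rw [hL, h]
  simp only [Finset.sum_range_succ, Finset.sum_range_zero, zero_add, Nat.sub_self, Nat.sub_zero,
    centralMoment_zero, centralMoment_one, centralMoment_three,
    centralMoment_two_of_squarefree hk₁, centralMoment_two_of_squarefree hk₂]
  push_cast
  norm_num [Nat.choose]
  ring

/-- **`Σ_{d∣k₁}Σ_{e∣k₂} A₁²A₂² = τ(k₁)τ(k₂)·(L⁴ − 2L²(P₂(k₁)+P₂(k₂)) + 3(P₂(k₁)+P₂(k₂))² − 2(P₄(k₁)+P₄(k₂)))/16`** for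
squarefree `k₁, k₂` (`(L²−δ²)²/16` summed: `J₂ = ττΣP₂`, `J₄ = ττ(3(ΣP₂)² − 2ΣP₄)`): the order-`(2,2)` top weight; new
decorations `τP₂(k₁)·τP₂(k₂)`, `τP₂²`, `τP₄`. [cite: KowalskiMichelVanderKam2000, (23)–(28) — derivation] -/
theorem sum_divisors_sum_divisors_A1_sq_mul_A2_sq_of_squarefree (X : ℝ) {k₁ k₂ : ℕ} (hk₁ : Squarefree k₁)
    (hk₂ : Squarefree k₂) :
    ∑ d ∈ k₁.divisors, ∑ e ∈ k₂.divisors,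
        (X - Real.log e - Real.log ((k₁ / d : ℕ) : ℝ)) ^ 2 * (X - Real.log d - Real.log ((k₂ / e : ℕ) : ℝ)) ^ 2 =
      (k₁.divisors.card : ℝ) * (k₂.divisors.card : ℝ) *
        (((2 * X - Real.log k₁ - Real.log k₂) ^ 4 -
          2 * (2 * X - Real.log k₁ - Real.log k₂) ^ 2 *
            ((∑ p ∈ k₁.primeFactors, Real.log p ^ 2) + ∑ p ∈ k₂.primeFactors, Real.log p ^ 2) +
          3 * ((∑ p ∈ k₁.primeFactors, Real.log p ^ 2) + ∑ p ∈ k₂.primeFactors, Real.log p ^ 2) ^ 2 -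
          2 * ((∑ p ∈ k₁.primeFactors, Real.log p ^ 4) + ∑ p ∈ k₂.primeFactors, Real.log p ^ 4)) / 16) := by
  rw [sum_divisors_sum_divisors_A1_pow_mul_A2_pow_eq X 2 2 k₁ k₂]
  simp only [Finset.sum_range_succ, Finset.sum_range_zero, zero_add, Nat.sub_self, Nat.sub_zero,
    centralMoment_zero, centralMoment_one, centralMoment_three,
    centralMoment_two_of_squarefree hk₁, centralMoment_two_of_squarefree hk₂,
    centralMoment_four_of_squarefree hk₁, centralMoment_four_of_squarefree hk₂]
  push_cast
  norm_num [Nat.choose]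
  ring

end Summit.Parity.GeneralizedHardyLittlewood.Theorems.MomentsBeyondDiagonal.DiagKernel

end
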